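import Mathlib
import Summits.AtomisticToContinuum.Crystallization.Theses.GappedShellCensus
import Literature.Geometry.DiscreteGeometry.ShellCensusTwelve
import Summits.AtomisticToContinuum.Crystallization.Theorems.GappedShellCensusFiveFoldRationingRStubFfrCensus4

/-!
# Crux `GappedShellCensus.ShellTrichotomy` (stmt-AtomisticToContinuum-18070) — the typed SPLIT
# `FccLabelledClose → HcpLabelledClose → ShellTrichotomy`

Strategist decomposition of the dichotomy census.  Its CENSUS HALF — an injective gapped
twelve-tuple all of whose labels have exactly four bonded partners carries, after a relabelling,
the labelled cuboctahedral bond graph (`sqNormInt (fccVec k − fccVec l) = 2`) or the labelled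
anticuboctahedral one (`sqNormInt (hcpVec k − hcpVec l) = 18`) — is IN THE TREE
(`stub_ffrCensus4`, computational lane, assembled from the fifteen landed bricks of line `Sketch`
and the verified growth search `ShellCensusSearch*`), and is used here BY NAME.  What remains are
the two genuine, independent METRIC pieces (each strictly weaker than the crux, neither the crux
reworded), spelled out INLINE below (they become the route's children when the split is applied):

* `FccLabelledClose` — a tolerant realization of the labelled cuboctahedral graph (radii and the
  24 bonds in `[0.98, 1.02]`, the 42 non-bonds `≥ 1.26`) is `TupleClose (1/5)` to `fccTuple`
  (numerical sup of the optimal-isometry bottleneck distance `0.1435`, margin `0.0565`);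
* `HcpLabelledClose` — the same for the labelled anticuboctahedral graph and `hcpTuple`
  (numerical sup `0.1833`, margin `0.0167`: the hard piece; maximiser = counter-rotating
  triangles + axial chair-buckling of the hexagon, cut by the gap on the six cupola-quad
  diagonals).

The proof is the sorry-free composition of line `Sketch` (`Cruxes/ShellTrichotomy/Lines/Sketch.lean`,
`shellTrichotomy_of_stubs`, leads 0 and c1 — all credit there): tuple form of the finite set,
degree bookkeeping, the syntactic capped / torn branches, relabelling invariance of the hypotheses
(`ffrC4_hyps_perm`), the census `stub_ffrCensus4`, and `shellCloseTo_of_tupleClose` +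
`image_fccTuple` / `image_hcpTuple` for the two `ShellCloseTo` disjuncts.
-- adapted from Cruxes/ShellTrichotomy/Lines/Sketch.lean (line Sketch, stmt-18070)
-/

noncomputable section

namespace Summit.AtomisticToContinuum.Crystallization.Theorems

open Literature.Geometry.DiscreteGeometry Literature.Geometry.DiscreteGeometry.ShellCensus
open Summit.AtomisticToContinuum.Crystallization.Theses.GappedShellCensus

/-- Degree bookkeeping: the shell-degree of `t k` inside `T = image t` equals the number of labels
`l ≠ k` with `t l` in the bond window. -/
theorem splitST_card_filter_image_eq (t : Fin 12 → EuclideanSpace ℝ (Fin 3))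
    (hinj : Function.Injective t) (k : Fin 12) :
    ((Finset.univ.image t).filter fun w => w ≠ t k ∧ dist (t k) w ≤ 1 + 1 / 50).card =
      (Finset.univ.filter fun l => l ≠ k ∧ dist (t k) (t l) ≤ 1 + 1 / 50).card := by
  classical
  rw [Finset.filter_image, Finset.card_image_of_injective _ hinj]
  congr 1
  ext l
  simp only [Finset.mem_filter, Finset.mem_univ, true_and, ne_eq, hinj.ne_iff]

/-- **The split of the crux** `ShellTrichotomy` (stmt-AtomisticToContinuum-18070) into its two
metric pieces `FccLabelledClose`, `HcpLabelledClose` (statements inline, in this order); the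
census half enters as the tree theorem `stub_ffrCensus4`.  Sorry-free glue for
`route edit --split ShellTrichotomy --into FccLabelledClose HcpLabelledClose --glue-by`. -/
theorem ShellTrichotomy_of_subs :
    (∀ t : Fin 12 → EuclideanSpace ℝ (Fin 3),
        (∀ k, 1 - 1 / 50 ≤ ‖t k‖ ∧ ‖t k‖ ≤ 1 + 1 / 50) →
        (∀ k l, k ≠ l → 1 - 1 / 50 ≤ dist (t k) (t l) ∧
          (dist (t k) (t l) ≤ 1 + 1 / 50 ∨ 63 / 50 ≤ dist (t k) (t l))) →
        (∀ k l, k ≠ l → (dist (t k) (t l) ≤ 1 + 1 / 50 ↔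
          Literature.Geometry.DiscreteGeometry.sqNormInt
            (Literature.Geometry.DiscreteGeometry.ShellCensus.fccVec k -
              Literature.Geometry.DiscreteGeometry.ShellCensus.fccVec l) = 2)) →
        Literature.Geometry.DiscreteGeometry.ShellCensus.TupleClose (1 / 5) t
          Literature.Geometry.DiscreteGeometry.ShellCensus.fccTuple) →
    (∀ t : Fin 12 → EuclideanSpace ℝ (Fin 3),
        (∀ k, 1 - 1 / 50 ≤ ‖t k‖ ∧ ‖t k‖ ≤ 1 + 1 / 50) →
        (∀ k l, k ≠ l → 1 - 1 / 50 ≤ dist (t k) (t l) ∧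
          (dist (t k) (t l) ≤ 1 + 1 / 50 ∨ 63 / 50 ≤ dist (t k) (t l))) →
        (∀ k l, k ≠ l → (dist (t k) (t l) ≤ 1 + 1 / 50 ↔
          Literature.Geometry.DiscreteGeometry.sqNormInt
            (Literature.Geometry.DiscreteGeometry.ShellCensus.hcpVec k -
              Literature.Geometry.DiscreteGeometry.ShellCensus.hcpVec l) = 18)) →
        Literature.Geometry.DiscreteGeometry.ShellCensus.TupleClose (1 / 5) t
          Literature.Geometry.DiscreteGeometry.ShellCensus.hcpTuple) →
    ShellTrichotomy := by
  classical
  intro hFcc hHcp T hT hnorm hdist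
  obtain ⟨t, hinj, rfl⟩ := exists_tuple_of_card T hT
  have hmem : ∀ k, t k ∈ Finset.univ.image t := fun k => Finset.mem_image_of_mem t (Finset.mem_univ k)
  have hn : ∀ k, 1 - 1 / 50 ≤ ‖t k‖ ∧ ‖t k‖ ≤ 1 + 1 / 50 := fun k => hnorm (t k) (hmem k)
  have hd : ∀ k l, k ≠ l → 1 - 1 / 50 ≤ dist (t k) (t l) ∧
      (dist (t k) (t l) ≤ 1 + 1 / 50 ∨ 63 / 50 ≤ dist (t k) (t l)) :=
    fun k l hkl => hdist (t k) (hmem k) (t l) (hmem l) (hinj.ne hkl)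
  -- branches (B) capped / (C) torn are syntactic
  by_cases hB : ∃ k, 5 ≤ (Finset.univ.filter fun l => l ≠ k ∧ dist (t k) (t l) ≤ 1 + 1 / 50).card
  · obtain ⟨k, hk⟩ := hB
    refine Or.inr (Or.inr (Or.inl ⟨t k, hmem k, ?_⟩))
    rwa [splitST_card_filter_image_eq t hinj k]
  by_cases hC : ∃ k, (Finset.univ.filter fun l => l ≠ k ∧ dist (t k) (t l) ≤ 1 + 1 / 50).card ≤ 3
  · obtain ⟨k, hk⟩ := hC
    refine Or.inr (Or.inr (Or.inr ⟨t k, hmem k, ?_⟩))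
    rwa [splitST_card_filter_image_eq t hinj k]
  -- otherwise every shell-degree is exactly four: the census half (tree theorem) relabels the
  -- tuple onto the cuboctahedral or the anticuboctahedral labelled graph
  push Not at hB hC
  have h4 : ∀ k, (Finset.univ.filter fun l => l ≠ k ∧ dist (t k) (t l) ≤ 1 + 1 / 50).card = 4 := by
    intro k; have := hB k; have := hC k; omega
  obtain ⟨σ, hσ⟩ := stub_ffrCensus4 t hinj hn hd h4
  obtain ⟨hn', hd'⟩ := ffrC4_hyps_perm t σ hn hd
  rcases hσ with hfcc | hhcp
  · left
    have hclose : TupleClose (1 / 5) (t ∘ σ) fccTuple := hFcc (t ∘ σ) hn' hd' hfcc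
    have h := shellCloseTo_of_tupleClose hinj fccTuple_injective (TupleClose.of_comp_perm σ hclose)
    rwa [image_fccTuple] at h
  · right; left
    have hclose : TupleClose (1 / 5) (t ∘ σ) hcpTuple := hHcp (t ∘ σ) hn' hd' hhcp
    have h := shellCloseTo_of_tupleClose hinj hcpTuple_injective (TupleClose.of_comp_perm σ hclose)
    rwa [image_hcpTuple] at h

end Summit.AtomisticToContinuum.Crystallization.Theorems

end
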